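import Summits.HodgeConjecture.HodgeConjecture.Theorems.PadicSemiregularLiftFermatAnchorAssemblyGMFBaseChange
import Mathlib.RingTheory.WittVector.Domain
import Mathlib.RingTheory.WittVector.Teichmuller
import Mathlib.RingTheory.WittVector.Identities
import Mathlib.RingTheory.Localization.FractionRing
import Mathlib.Algebra.CharP.Algebra

/-!
# `stub_eulerBaseChange`, auxiliary file (line `witt-lift-rigid-mf` of crux `FermatAnchorAssembly`, stmt-HodgeConjecture-14874):
the characteristic-zero model of a Witt-vector factorization — data, and the reduction to Euler-form invariance

Route `PadicSemiregularLift` of `HodgeConjecture`; vocabulary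
`Theorems/PadicSemiregularLiftFermatAnchorAssemblyGMFDefs.lean`, lawful base change / twist
`Theorems/PadicSemiregularLiftFermatAnchorAssemblyGMFBaseChange.lean`.

The registered stub `stub_eulerBaseChange` asks, for a lawful `L`-graded factorization `M_W` of `Σ xᵢᵐ` over
`𝕎 𝕜` (`𝕜` perfect of characteristic `p ∤ m`, `ζ ∈ 𝕜` a primitive `m`-th root of unity), for a
`CharZeroModel`: a field `K ⊇ ℚ`, a primitive `m`-th root `ζ_K ∈ K` and a lawful factorization `N` over `K`
whose charge polynomial `Θ_{γ,N}` (w.r.t. `ζ_K`) equals `Θ_{γ, M_W ⊗ 𝕜}` (w.r.t. `ζ`). This file lands the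
DATA of the model and isolates the residual content as ONE equation:

* `charZero_wittVector` — `𝕎 𝕜` has characteristic `0` (`(p : 𝕎 𝕜) ≠ 0`, `WittVector.p_nonzero`, and the
  residue map `constantCoeff` rules out every other prime characteristic); hence so does `K := Frac 𝕎 𝕜`;
* `isPrimitiveRoot_teichmuller`, `isPrimitiveRoot_algebraMap_teichmuller` — the Teichmüller lift
  `τ := teichmuller p ζ` and its image `ζ_K ∈ K` are primitive `m`-th roots (injective monoid maps);
* `N := M_W.baseChange (algebraMap (𝕎 𝕜) K)` is lawful (`GMF.baseChange`), `M_W ⊗ 𝕜 = M_W.baseChange constantCoeff`,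
  and `g^*` commutes with both base changes (`GMFData.twist_map`, `constantCoeff τ = ζ`), so that
  coefficientwise `Θ_{γ,N} = Θ_{γ,M_W ⊗ 𝕜}` reads `χ_K(M_W ⊗ K, (g^*_τ M_W) ⊗ K) = χ_𝕜(M_W ⊗ 𝕜, (g^*_τ M_W) ⊗ 𝕜)`
  for the lawful pair `(M_W, g^*_τ M_W)` (`GMF.twist`, `τᵐ = 1`);
* `stub_eulerBaseChange_of_eulerForm_baseChange` — HENCE THE STUB FOLLOWS FROM THE EULER-FORM BASE-CHANGE
  INVARIANCE `EulerFormBaseChange`-shaped hypothesis (spelled out, not a definition): for every pair of lawful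
  factorizations `M₁, M₂` over `𝕎 𝕜`, `p ∤ m`,
  `eulerForm (Frac 𝕎 𝕜) L (M₁ ⊗ K) (M₂ ⊗ K) = eulerForm 𝕜 L (M₁ ⊗ 𝕜) (M₂ ⊗ 𝕜)`
  (homological algebra: the `ℤ`-graded Hom complex of the pair is a complex of finite free `𝕎`-modules
  computing both sides after `⊗ K`, `⊗ 𝕜`; its cohomology is bounded on both fibres because `m` is
  invertible on both (`xᵢ^{m-1}` is null-homotopic), and ranks over `K` and `𝕜` of its differentials then
  agree outside a bounded window, where the two Euler characteristics telescope to the same number).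

No named fact, no `sorry`; the residual equation is the precise remaining content of the stub.
-/

-- `Summit.HodgeConjecture.HodgeConjecture.…` is the tree's mandated summit/problem namespace (single-problem summit).
set_option linter.dupNamespace false

noncomputable section

open Finset

namespace Summit.HodgeConjecture.HodgeConjecture.Cruxes.FermatAnchorAssembly.WittLiftRigidMf

/-! ### H1 — the Witt vectors of a field of characteristic `p` have characteristic `0` -/

/-- **`𝕎 𝕜` has characteristic zero** for a field `𝕜` of characteristic `p`: `𝕎 𝕜` is a domain
(`WittVector.instIsDomain`), so its characteristic is `0` or a prime `q` with `(q : 𝕎 𝕜) = 0`; `q = p` is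
excluded by `WittVector.p_nonzero` (`coeff₁ p = 1`), and `q ≠ p` by the residue map
`constantCoeff : 𝕎 𝕜 →+* 𝕜` (`(q : 𝕜) ≠ 0`). [folklore] -/
theorem charZero_wittVector : ∀ (p : ℕ) [Fact p.Prime] (𝕜 : Type) [Field 𝕜] [CharP 𝕜 p],
    CharZero (WittVector p 𝕜) := by
  intro p _ 𝕜 _ _
  obtain ⟨q, hq⟩ := CharP.exists (WittVector p 𝕜)
  rcases CharP.char_is_prime_or_zero (WittVector p 𝕜) q with hprime | rfl
  · exfalso
    have h1 : (q : WittVector p 𝕜) = 0 := CharP.cast_eq_zero _ q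
    have h2 : (q : 𝕜) = 0 := by
      have h := congrArg (WittVector.constantCoeff : WittVector p 𝕜 →+* 𝕜) h1
      rwa [map_natCast, map_zero] at h
    have h3 : p ∣ q := (CharP.cast_eq_zero_iff 𝕜 p q).mp h2
    have h4 : p = q := (Nat.prime_dvd_prime_iff_eq (Fact.out : p.Prime) hprime).mp h3
    subst h4
    exact WittVector.p_nonzero p 𝕜 h1
  · exact CharP.charP_to_charZero (WittVector p 𝕜)

/-- `Frac 𝕎 𝕜` has characteristic zero. [folklore] -/
theorem charZero_fractionRing_wittVector : ∀ (p : ℕ) [Fact p.Prime] (𝕜 : Type) [Field 𝕜] [CharP 𝕜 p],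
    CharZero (FractionRing (WittVector p 𝕜)) := by
  intro p _ 𝕜 _ _
  haveI := charZero_wittVector p 𝕜
  exact charZero_of_injective_algebraMap
    (IsFractionRing.injective (WittVector p 𝕜) (FractionRing (WittVector p 𝕜)))

/-! ### H1' — the Teichmüller lift of a primitive root is primitive -/

/-- The Teichmüller map is injective (`coeff₀ ∘ teichmuller = id`). [folklore] -/
theorem teichmuller_injective (p : ℕ) [Fact p.Prime] (𝕜 : Type) [CommRing 𝕜] :
    Function.Injective (WittVector.teichmuller p : 𝕜 → WittVector p 𝕜) := by
  intro a b hab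
  simpa using congrArg (fun x : WittVector p 𝕜 ↦ x.coeff 0) hab

/-- **The Teichmüller lift of a primitive `m`-th root of unity is a primitive `m`-th root of unity**
(`teichmuller` is a monoid map and injective). [folklore] -/
theorem isPrimitiveRoot_teichmuller : ∀ (p : ℕ) [Fact p.Prime] (𝕜 : Type) [CommRing 𝕜] (m : ℕ) (ζ : 𝕜),
    IsPrimitiveRoot ζ m → IsPrimitiveRoot (WittVector.teichmuller p ζ) m := by
  intro p _ 𝕜 _ m ζ hζ
  exact hζ.map_of_injective (teichmuller_injective p 𝕜)

/-- **Its image in `Frac 𝕎 𝕜` is a primitive `m`-th root of unity** (`𝕎 𝕜 ↪ Frac 𝕎 𝕜` for a domain). [folklore] -/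
theorem isPrimitiveRoot_algebraMap_teichmuller : ∀ (p : ℕ) [Fact p.Prime] (𝕜 : Type) [Field 𝕜] [CharP 𝕜 p]
    (m : ℕ) (ζ : 𝕜), IsPrimitiveRoot ζ m →
    IsPrimitiveRoot (algebraMap (WittVector p 𝕜) (FractionRing (WittVector p 𝕜))
      (WittVector.teichmuller p ζ)) m := by
  intro p _ 𝕜 _ _ m ζ hζ
  exact (isPrimitiveRoot_teichmuller p 𝕜 m ζ hζ).map_of_injective
    (IsFractionRing.injective (WittVector p 𝕜) (FractionRing (WittVector p 𝕜)))

/-- The residue of the Teichmüller lift: `constantCoeff (teichmuller p ζ) = ζ`. [folklore] -/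
theorem constantCoeff_teichmuller (p : ℕ) [Fact p.Prime] (𝕜 : Type) [CommRing 𝕜] (ζ : 𝕜) :
    (WittVector.constantCoeff : WittVector p 𝕜 →+* 𝕜) (WittVector.teichmuller p ζ) = ζ := by
  simp

/-! ### H3 + reduction — the stub follows from Euler-form base-change invariance -/

/-- **Reduction of `stub_eulerBaseChange` to the Euler-form base-change invariance.** Granted that for
every pair of lawful `L`-graded factorizations `M₁, M₂` of `Σ xᵢᵐ` over `𝕎 𝕜` (`p ∤ m`) the Euler form is
the same on the two fibres, `χ_{Frac 𝕎}(M₁ ⊗ K, M₂ ⊗ K) = χ_𝕜(M₁ ⊗ 𝕜, M₂ ⊗ 𝕜)`, the characteristic-zero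
model exists: `K := Frac 𝕎 𝕜` (characteristic `0`), `ζ_K :=` the image of `teichmuller p ζ` (primitive),
`N := M_W ⊗ K` (lawful), and `Θ_{γ,N} = Θ_{γ,M_W ⊗ 𝕜}` coefficient by coefficient, the coefficient of
index `g` being the invariance for the lawful pair `(M_W, g^*_τ M_W)` transported through
`g^*(M_W ⊗ K) = (g^*_τ M_W) ⊗ K`, `g^*(M_W ⊗ 𝕜) = (g^*_τ M_W) ⊗ 𝕜` (`constantCoeff τ = ζ`). [folklore] -/
theorem stub_eulerBaseChange_of_eulerForm_baseChange :
    (∀ (p : ℕ) [Fact p.Prime] (𝕜 : Type) [Field 𝕜] [CharP 𝕜 p] [PerfectRing 𝕜 p] (ν m : ℕ), ¬ p ∣ m →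
      ∀ (ι₀ ι₁ κ₀ κ₁ : Type) [Fintype ι₀] [Fintype ι₁] [Fintype κ₀] [Fintype κ₁]
        [DecidableEq ι₀] [DecidableEq ι₁] [DecidableEq κ₀] [DecidableEq κ₁]
        (L : AddSubgroup (Fin ν → ZMod m)) (M₁ : GMF (WittVector p 𝕜) ν m L ι₀ ι₁)
        (M₂ : GMF (WittVector p 𝕜) ν m L κ₀ κ₁),
        GMFData.eulerForm (FractionRing (WittVector p 𝕜)) L
            (M₁.toGMFData.map (algebraMap (WittVector p 𝕜) (FractionRing (WittVector p 𝕜))))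
            (M₂.toGMFData.map (algebraMap (WittVector p 𝕜) (FractionRing (WittVector p 𝕜)))) =
          GMFData.eulerForm 𝕜 L (M₁.toGMFData.map (WittVector.constantCoeff : WittVector p 𝕜 →+* 𝕜))
            (M₂.toGMFData.map (WittVector.constantCoeff : WittVector p 𝕜 →+* 𝕜))) →
    ∀ (p : ℕ) [Fact p.Prime] (𝕜 : Type) [Field 𝕜] [CharP 𝕜 p] [PerfectRing 𝕜 p] (ν m : ℕ) [NeZero m],
    ¬ p ∣ m → ∀ (ζ : 𝕜), IsPrimitiveRoot ζ m → ∀ (γ : Fin ν → ZMod m)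
    (ι₀ ι₁ : Type) [Fintype ι₀] [Fintype ι₁] [DecidableEq ι₀] [DecidableEq ι₁]
    (L : AddSubgroup (Fin ν → ZMod m)) (MW : GMF (WittVector p 𝕜) ν m L ι₀ ι₁),
    Nonempty (CharZeroModel L ι₀ ι₁ γ
      (GMFData.thetaPoly 𝕜 L ζ γ (MW.toGMFData.map (WittVector.constantCoeff : WittVector p 𝕜 →+* 𝕜)))) := by
  intro hE p _ 𝕜 _ _ _ ν m _ hpm ζ hζ γ ι₀ ι₁ _ _ _ _ L MW
  haveI : CharZero (FractionRing (WittVector p 𝕜)) := charZero_fractionRing_wittVector p 𝕜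
  set τ : WittVector p 𝕜 := WittVector.teichmuller p ζ with hτdef
  have hτ : τ ^ m = 1 := (isPrimitiveRoot_teichmuller p 𝕜 m ζ hζ).pow_eq_one
  have hζτ : (WittVector.constantCoeff : WittVector p 𝕜 →+* 𝕜) τ = ζ := constantCoeff_teichmuller p 𝕜 ζ
  refine ⟨{ K := FractionRing (WittVector p 𝕜)
            ζ := algebraMap (WittVector p 𝕜) (FractionRing (WittVector p 𝕜)) τ
            prim := isPrimitiveRoot_algebraMap_teichmuller p 𝕜 m ζ hζ
            N := MW.baseChange (algebraMap (WittVector p 𝕜) (FractionRing (WittVector p 𝕜)))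
            theta_eq := ?_ }⟩
  simp only [GMFData.thetaPoly]
  refine Finset.sum_congr rfl fun g _ ↦ ?_
  congr 1
  conv_rhs => rw [← hζτ]
  rw [GMF.baseChange_toGMFData, GMFData.twist_map, GMFData.twist_map, ← GMF.twist_toGMFData τ hτ g MW]
  exact hE p 𝕜 ν m hpm ι₀ ι₁ ι₀ ι₁ L MW (MW.twist τ hτ g)

end Summit.HodgeConjecture.HodgeConjecture.Cruxes.FermatAnchorAssembly.WittLiftRigidMf

end
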